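import Literature.NumberTheory.LFunctions.KowalskiMichelPeterssonJBoundAllLevels
import Literature.NumberTheory.EllipticCurves.HeckeEisensteinWeightOneForm
import HarnessLib

/-!
# The `q`-series of the weight-2 Poincaré series is holomorphic on `ℍ`

Topic `Literature/NumberTheory/ModularForms` (namespace `Literature.NumberTheory.ModularForms.PoincareWeightTwo`,
continuing `PoincareSeriesWeightTwoHecke.lean`). THEOREMS ONLY. The printed Fourier series
`Σ_{n≥1} p_m(n) e(nz)` of the weight-2 Poincaré series of `Γ₀(N)` (Iwaniec–Kowalski Lemma 14.2;
`poincareQSeries N m`, coefficients `poincareCoeff N m n = δ(m,n) − √n/√m·J_N(m,n)`) converges absolutely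
and defines a holomorphic function on `ℍ`, because its coefficients grow polynomially
(`KowalskiMichel2000.norm_poincareCoeff_le`, from Weil's bound: `|p_m(n)| ≤ 1 + K n^{3/2}`) — the
tree's `mdifferentiable_of_eq_qSeries` (a `q`-series with coefficients `O((n+1)ᵏ)` is holomorphic).
This is the holomorphy input of the assembly stub T7 (`stub_poincareAssembly`) of the I1 fact skeleton
`Summits/Parity/GeneralizedHardyLittlewood/Cruxes/PeterssonBoundPrinted/Lines/poincare_hecke.lean`.

* `poincareQSeries_eq_qSeries` — the series as `Σ aₙ qⁿ`, `q = e(z)`, `a₀ = 0`, `aₙ = p_m(n)`;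
* `norm_poincareCoeff_le_pow` — `|aₙ| ≤ (1 + K)(n + 1)²`;
* `mdifferentiable_poincareQSeries` — `poincareQSeries N m` is `MDifferentiable` on `ℍ` (`m ≥ 1`).

## References

* [IwaniecKowalski2004] H. Iwaniec, E. Kowalski, *Analytic Number Theory*, Lemma 14.2 ((14.15)).
* [KowalskiMichel2000] E. Kowalski, P. Michel, Acta Arith. 94 (2000), §2.4.2 p. 312 ((23)).
-/

noncomputable section

open scoped Real Manifold
open Complex
open Literature.NumberTheory.LFunctions.KowalskiMichel2000 (norm_poincareCoeff_le)
open Literature.NumberTheory.EllipticCurves.ModularForms (mdifferentiable_of_eq_qSeries)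

namespace Literature.NumberTheory.ModularForms.PoincareWeightTwo

/-- The `q`-series of the Poincaré coefficients written as `Σₙ aₙ e(z)ⁿ` with `a₀ = 0`, `aₙ = p_m(n)`.
[cite: IwaniecKowalski2004, Lemma 14.2] -/
theorem poincareQSeries_eq_qSeries (N : ℕ) [NeZero N] (m : ℕ) (z : UpperHalfPlane) :
    poincareQSeries N m z =
      ∑' n : ℕ, (if n = 0 then 0 else poincareCoeff N m n) * cexp (2 * π * Complex.I * z) ^ n := by
  unfold poincareQSeries
  congr 1
  funext n
  split_ifs with h
  · rw [zero_mul]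
  · rw [← Complex.exp_nat_mul]
    congr 2
    ring

/-- Polynomial growth of the coefficients in the shape `|aₙ| ≤ C (n+1)ᵏ`: with the absolute `K` of
`norm_poincareCoeff_le`, `|aₙ| ≤ (1 + K) (n + 1)²`. [cite: IwaniecKowalski2004, Lemma 14.2 ((14.15))] -/
theorem norm_poincareCoeff_le_pow :
    ∃ C : ℝ, 0 ≤ C ∧ ∀ (N : ℕ) [NeZero N] (m : ℕ), 1 ≤ m → ∀ n : ℕ,
      ‖(if n = 0 then (0 : ℂ) else poincareCoeff N m n)‖ ≤ C * ((n : ℝ) + 1) ^ 2 := by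
  obtain ⟨K, hK0, hK⟩ := norm_poincareCoeff_le
  refine ⟨1 + K, by positivity, fun N _ m hm n ↦ ?_⟩
  split_ifs with h
  · rw [norm_zero]; positivity
  have hn : 1 ≤ n := Nat.one_le_iff_ne_zero.mpr h
  have hn0 : (0 : ℝ) ≤ n := Nat.cast_nonneg n
  have hsq : Real.sqrt (n : ℝ) ≤ (n : ℝ) + 1 := by
    rw [Real.sqrt_le_left (by positivity)]
    nlinarith
  have h1 : (1 : ℝ) ≤ ((n : ℝ) + 1) ^ 2 := by nlinarith
  have h2 : K * (n : ℝ) * Real.sqrt n ≤ K * ((n : ℝ) + 1) ^ 2 := by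
    rw [mul_assoc]
    refine mul_le_mul_of_nonneg_left ?_ hK0
    nlinarith [Real.sqrt_nonneg (n : ℝ)]
  calc ‖poincareCoeff N m n‖ ≤ 1 + K * (n : ℝ) * Real.sqrt n := hK N m n hm hn
    _ ≤ ((n : ℝ) + 1) ^ 2 + K * ((n : ℝ) + 1) ^ 2 := add_le_add h1 h2
    _ = (1 + K) * ((n : ℝ) + 1) ^ 2 := by ring

/-- **The `q`-series `Σ_{n≥1} p_m(n) e(nz)` of the weight-2 Poincaré series is holomorphic on `ℍ`**
(`m ≥ 1`, any level `N ≥ 1`): polynomially bounded coefficients (Weil) and the tree's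
`mdifferentiable_of_eq_qSeries`. [cite: IwaniecKowalski2004, Lemma 14.2] -/
theorem mdifferentiable_poincareQSeries (N : ℕ) [NeZero N] {m : ℕ} (hm : 1 ≤ m) :
    MDifferentiable 𝓘(ℂ) 𝓘(ℂ) (poincareQSeries N m) := by
  obtain ⟨C, -, hC⟩ := norm_poincareCoeff_le_pow
  exact mdifferentiable_of_eq_qSeries (fun n ↦ hC N m hm n) (poincareQSeries_eq_qSeries N m)

end Literature.NumberTheory.ModularForms.PoincareWeightTwo

end
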